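import Mathlib
import HarnessLib
import Literature.Analysis.FluidPDE.SelfSimilar
import Literature.Analysis.FluidPDE.TypeIAncientMild
import Literature.Analysis.FluidPDE.Vorticity
import Literature.Analysis.FluidPDE.VorticityEquation
import Literature.Analysis.FluidPDE.SpaceTimeCalculus
import Literature.Analysis.FluidPDE.DirectionDissipation
import Literature.Analysis.FluidPDE.TaoEnstrophyLocalisation
import Literature.Analysis.FluidPDE.ParabolicComparison
import Literature.Analysis.FluidPDE.ElgindiBlowup
import Summits.NavierStokesRegularity.NavierStokesRegularity.Theorems.HalfSpaceWindowDoorCirculationCarryingRigidityDefs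
import Summits.NavierStokesRegularity.NavierStokesRegularity.Theorems.HalfSpaceWindowDoorCirculationCarryingRigiditySubcriticalStretching
import Summits.NavierStokesRegularity.NavierStokesRegularity.Theorems.SqueezeCycleExtremalElementExistsRescale
import Summits.NavierStokesRegularity.NavierStokesRegularity.Theorems.SqueezeCycleExtremalElementExistsExtraction
import Summits.NavierStokesRegularity.NavierStokesRegularity.Theorems.SqueezeCycleExtremalElementExistsRegularity
import Summits.NavierStokesRegularity.NavierStokesRegularity.Theorems.PoloidalWindowDoorPoloidalWindowRigidityWindow
import Summits.NavierStokesRegularity.NavierStokesRegularity.Theorems.ChiralWindowDoorClassDerivDecay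

/-!
# Route `HalfSpaceWindowDoor`, crux `CirculationCarryingRigidity` (stmt-NavierStokesRegularity-25311) —
# the EXTREMAL-PROFILE REDUCTION of the open stub `StubLayerExclusion ≡ HemisphereLiouvilleE3`

The open research stub says: closed-hemisphere profiles of the route's Type-I ancient Oseen-mild class
(`⟪curl v, e₃⟫ ≥ 0`) are poloidal along `e₃`.  This file types the compactness half of the maximum-principle
blueprint (KNSS 2009 Thm 5.1-style) for the SCALE-INVARIANT `e₃`-VORTICITY `Λ_v(t,x) = (−t)·⟪curl v(t)(x), e₃⟫`
(invariant under the Navier–Stokes zoom `v ↦ c v(c²t, x₀ + c x)` and nonnegative on the closed-hemisphere class):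

* `inner_curl_zoom_e3` — `⟪curl (c v(c²s, x₀ + c·))(y), e₃⟫ = c² ⟪curl v(c²s)(x₀ + c y), e₃⟫`;
* `exists_extremal_typeIAncientMild` — **the supremum of `Λ` over the closed-hemisphere part of the class
  `IsTypeIAncientMild C` is ATTAINED**: if one closed-hemisphere member has `⟪curl v(t₁)(x₁), e₃⟫ > 0`, then there
  are a closed-hemisphere member `W` (same `C`) and `M > 0` with `⟪curl W(−1)(0), e₃⟫ = M` and `Λ_v ≤ M` for EVERY
  closed-hemisphere member `v` (uniform gradient bound KNSS Prop. 4.1 `exists_norm_iteratedFDeriv_le_of_typeI`,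
  zoom invariance `isTypeIAncientMild_zoom`, `C¹_loc` compactness `exists_tendsto_of_isTypeIAncientMild_seq`; the
  sign and the value pass to the limit because the vorticity converges pointwise);
* `exists_extremal_hemisphereProfile` — the same in the door's vocabulary (Type-I rate, continuity, Oseen–Duhamel
  identity, divergence-free slices);
* `extremal_point_conditions` — **what holds at the extremal point `(−1, 0)`** of such a `W`: `∇ω₃ = 0`, `Δω₃ ≤ 0`,
  `∂ₛω₃ = M`, and the `e₃`-STRETCHING IS AT LEAST THE SIMILARITY RATE, `⟪DW(−1,0)[curl W(−1,0)], e₃⟫ = M − Δω₃ ≥ M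
  = ω₃(−1,0)` (first/second-order conditions + the `e₃`-vorticity equation `hasDerivAt_inner_curl_e3`) — the
  equality case `θ = 1` of the subcritical-stretching exclusion (`…SubcriticalStretching`);
* `hemisphereLiouvilleE3_iff_no_extremal` — **REDUCTION**: `HemisphereLiouvilleE3` ⟺ «no closed-hemisphere
  door-class profile attains a positive maximum of `(−s)·⟪curl v(s)(y), e₃⟫ at `(−1, 0)`».  The research content
  of 25311 is therefore the exclusion of ONE normalized object: an EXTREMAL closed-hemisphere profile.

Seat ns-hsw-p1 g2 (LEAD of 25311, cell pub-ns-dss).  WHAT THIS IS NOT: not a statement about Navier–Stokes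
regularity; the door statements are regularity CRITERIA about HYPOTHETICAL blow-up profiles (KNSS ancient mild
solutions); a reduction of the open stub (helper `--supports` 25311), not its closure.
-/

noncomputable section

-- the summit and its single sub-problem share the name (CONVENTIONS §1), as in every Theorems file
set_option linter.dupNamespace false

namespace Summit.NavierStokesRegularity.NavierStokesRegularity.Theorems.HalfSpaceWindowDoorCirculationCarryingRigidityExtremalProfile

open Set Function Filter Topology Metric
open scoped RealInnerProductSpace InnerProductSpace Laplacian ContDiff
open Literature.Analysis Literature.Analysis.FluidPDE
open Summit.NavierStokesRegularity.NavierStokesRegularity.Theorems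
open Summit.NavierStokesRegularity.NavierStokesRegularity.Theorems.HalfSpaceWindowDoorCirculationCarryingRigidityDefs
open Summit.NavierStokesRegularity.NavierStokesRegularity.Theorems.HalfSpaceWindowDoorCirculationCarryingRigiditySubcriticalStretching
  (hasDerivAt_inner_curl_e3 fderiv_inner_e3_apply laplacian_inner_e3 inner_e3_le_norm)
open Summit.NavierStokesRegularity.NavierStokesRegularity.Theorems.PoloidalWindowDoorPoloidalWindowRigidityWindow
  (isTypeIAncientMild_of_class)
open Summit.NavierStokesRegularity.NavierStokesRegularity.Theorems.ChiralWindowDoorClassDerivDecay (exists_classical_of_class)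

/-! ### The scale-invariant `e₃`-vorticity under the Navier–Stokes zoom -/

/-- **`e₃`-vorticity of the zoomed field**: for the zoom `w = c • stPull (c²) c 0 x₀ u`, `w(s,y) = c u(c²s, x₀ + c y)`,
one has `⟪curl w(s)(y), e₃⟫ = c² ⟪curl u(c²s)(x₀ + c y), e₃⟫` (chain rule, no differentiability needed). [folklore] -/
theorem inner_curl_zoom_e3 (c : ℝ) (x₀ : EuclideanSpace ℝ (Fin 3))
    (u : ℝ → EuclideanSpace ℝ (Fin 3) → EuclideanSpace ℝ (Fin 3)) (s : ℝ) (y : EuclideanSpace ℝ (Fin 3)) :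
    ⟪curl ((c • stPull (c ^ 2) c 0 x₀ u) s) y, e3⟫ = c ^ 2 * ⟪curl (u (c ^ 2 * s)) (x₀ + c • y), e3⟫ := by
  rw [curl_smul_stPull, zero_add, inner_smul_left, ← sq]
  simp

/-- The closed-hemisphere condition is invariant under the zoom. [folklore] -/
theorem sign_zoom {u : ℝ → EuclideanSpace ℝ (Fin 3) → EuclideanSpace ℝ (Fin 3)}
    (hsg : ∀ t < 0, ∀ x, 0 ≤ ⟪curl (u t) x, e3⟫) {c : ℝ} (hc : 0 < c) (x₀ : EuclideanSpace ℝ (Fin 3)) :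
    ∀ s < 0, ∀ y, 0 ≤ ⟪curl ((c • stPull (c ^ 2) c 0 x₀ u) s) y, e3⟫ := by
  intro s hs y
  rw [inner_curl_zoom_e3]
  exact mul_nonneg (sq_nonneg c) (hsg _ (mul_neg_of_pos_of_neg (pow_pos hc 2) hs) _)

/-- Pointwise convergence of the gradients gives pointwise convergence of the `e₃`-vorticities
(`curl = curlCLM ∘ D` is a fixed linear map of the gradient). [folklore] -/
theorem tendsto_inner_curl_e3_of_tendsto_fderiv {w : ℕ → EuclideanSpace ℝ (Fin 3) → EuclideanSpace ℝ (Fin 3)}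
    {W : EuclideanSpace ℝ (Fin 3) → EuclideanSpace ℝ (Fin 3)} {x : EuclideanSpace ℝ (Fin 3)}
    (h : Tendsto (fun j => fderiv ℝ (w j) x) atTop (𝓝 (fderiv ℝ W x))) :
    Tendsto (fun j => ⟪curl (w j) x, e3⟫) atTop (𝓝 ⟪curl W x, e3⟫) := by
  have hc : Tendsto (fun j => curl (w j) x) atTop (𝓝 (curl W x)) := by
    simp_rw [curl_eq_curlCLM]
    exact (curlCLM.continuous.tendsto _).comp h
  exact hc.inner tendsto_const_nhds

/-! ### The supremum of the scale-invariant `e₃`-vorticity over the closed-hemisphere class is attained -/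

/-- **Extremal closed-hemisphere element of the Type-I ancient mild class.**  Let `u ∈ IsTypeIAncientMild C` be
closed-hemisphere (`⟪curl u(t), e₃⟫ ≥ 0` on every slice) with `⟪curl u(t₁)(x₁), e₃⟫ > 0` at some `t₁ < 0`.  Then there
are a closed-hemisphere `W ∈ IsTypeIAncientMild C` and `M > 0` with `⟪curl W(−1)(0), e₃⟫ = M` and
`(−t)·⟪curl v(t)(x), e₃⟫ ≤ M` for every closed-hemisphere `v ∈ IsTypeIAncientMild C`, every `t < 0`, `x`
(module docstring). [cite: KochNadirashviliSereginSverak2009, Prop. 4.1 and Lemma 6.1 (arXiv:0709.3599 pp. 8, 11)] -/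
theorem exists_extremal_typeIAncientMild (C : ℝ)
    {u : ℝ → EuclideanSpace ℝ (Fin 3) → EuclideanSpace ℝ (Fin 3)} (hu : IsTypeIAncientMild C u)
    (hsg : ∀ t < 0, ∀ x, 0 ≤ ⟪curl (u t) x, e3⟫)
    {t₁ : ℝ} (ht₁ : t₁ < 0) {x₁ : EuclideanSpace ℝ (Fin 3)} (hpos : 0 < ⟪curl (u t₁) x₁, e3⟫) :
    ∃ W : ℝ → EuclideanSpace ℝ (Fin 3) → EuclideanSpace ℝ (Fin 3), IsTypeIAncientMild C W ∧
      (∀ t < 0, ∀ x, 0 ≤ ⟪curl (W t) x, e3⟫) ∧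
      ∃ M : ℝ, 0 < M ∧ ⟪curl (W (-1)) 0, e3⟫ = M ∧
        ∀ v : ℝ → EuclideanSpace ℝ (Fin 3) → EuclideanSpace ℝ (Fin 3), IsTypeIAncientMild C v →
          (∀ t < 0, ∀ x, 0 ≤ ⟪curl (v t) x, e3⟫) → ∀ t < 0, ∀ x, (-t) * ⟪curl (v t) x, e3⟫ ≤ M := by
  -- the closed-hemisphere clause as a predicate
  set Sg : (ℝ → EuclideanSpace ℝ (Fin 3) → EuclideanSpace ℝ (Fin 3)) → Prop := fun v =>
    ∀ t < 0, ∀ x, 0 ≤ ⟪curl (v t) x, e3⟫ with hSg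
  change Sg u at hsg
  -- ## the normalisation to `(-1, 0)` by the zoom about `(0, x)` with factor `√(-t)`
  have hzoom : ∀ v : ℝ → EuclideanSpace ℝ (Fin 3) → EuclideanSpace ℝ (Fin 3),
      IsTypeIAncientMild C v → Sg v → ∀ t < 0, ∀ x,
        ∃ v' : ℝ → EuclideanSpace ℝ (Fin 3) → EuclideanSpace ℝ (Fin 3),
          IsTypeIAncientMild C v' ∧ Sg v' ∧
            ⟪curl (v' (-1)) 0, e3⟫ = (-t) * ⟪curl (v t) x, e3⟫ := by
    intro v hv hvs t ht x
    set c : ℝ := Real.sqrt (-t) with hcdef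
    have hc : 0 < c := Real.sqrt_pos.2 (neg_pos.2 ht)
    have hc2 : c ^ 2 = -t := Real.sq_sqrt (neg_pos.2 ht).le
    refine ⟨c • stPull (c ^ 2) c 0 x v, isTypeIAncientMild_zoom hv hc x, sign_zoom hvs hc x, ?_⟩
    rw [inner_curl_zoom_e3, smul_zero, add_zero, hc2, show -t * (-1) = t by ring]
  -- ## the class-uniform bound at `t = -1`, hence everywhere
  obtain ⟨K, hK⟩ := exists_norm_iteratedFDeriv_le_of_typeI C 1 (a := -3) (b := -(1 / 2)) (δ := 1)
    (by norm_num) (by norm_num) one_pos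
  have hK1 : ∀ v : ℝ → EuclideanSpace ℝ (Fin 3) → EuclideanSpace ℝ (Fin 3),
      IsTypeIAncientMild C v → ⟪curl (v (-1)) 0, e3⟫ ≤ 4 * K := by
    intro v hv
    have h := hK hv.continuousOn_uncurry (fun t ht => hv.isWeaklyDivFree ht)
      (fun s t hst ht x => hv.mild_eq_heatExtension hst ht x) hv.hasTypeITimeDecay (-1)
      ⟨by norm_num, by norm_num⟩ 0
    rw [norm_iteratedFDeriv_one] at h
    calc ⟪curl (v (-1)) 0, e3⟫ ≤ ‖curl (v (-1)) 0‖ := inner_e3_le_norm _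
      _ ≤ 4 * ‖fderiv ℝ (v (-1)) 0‖ := norm_curl_le_four_mul (v (-1)) 0
      _ ≤ 4 * K := by gcongr
  have hbound : ∀ v : ℝ → EuclideanSpace ℝ (Fin 3) → EuclideanSpace ℝ (Fin 3),
      IsTypeIAncientMild C v → Sg v → ∀ t < 0, ∀ x, (-t) * ⟪curl (v t) x, e3⟫ ≤ 4 * K := by
    intro v hv hvs t ht x
    obtain ⟨v', hv', -, heq⟩ := hzoom v hv hvs t ht x
    rw [← heq]
    exact hK1 v' hv'
  -- ## the supremum
  set S : Set ℝ := {Λ | ∃ (v : ℝ → EuclideanSpace ℝ (Fin 3) → EuclideanSpace ℝ (Fin 3)) (t : ℝ)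
    (x : EuclideanSpace ℝ (Fin 3)), IsTypeIAncientMild C v ∧ Sg v ∧ t < 0 ∧
      Λ = (-t) * ⟪curl (v t) x, e3⟫} with hS
  have hSbdd : BddAbove S :=
    ⟨4 * K, by rintro Λ ⟨v, t, x, hv, hvs, ht, rfl⟩; exact hbound v hv hvs t ht x⟩
  have hmemS : ∀ v t x, IsTypeIAncientMild C v → Sg v → t < 0 → (-t) * ⟪curl (v t) x, e3⟫ ∈ S :=
    fun v t x hv hvs ht => ⟨v, t, x, hv, hvs, ht, rfl⟩
  have hSne : S.Nonempty := ⟨_, hmemS u t₁ x₁ hu hsg ht₁⟩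
  set M : ℝ := sSup S with hM
  have hle : ∀ v t x, IsTypeIAncientMild C v → Sg v → t < 0 → (-t) * ⟪curl (v t) x, e3⟫ ≤ M :=
    fun v t x hv hvs ht => le_csSup hSbdd (hmemS v t x hv hvs ht)
  have hMpos : 0 < M :=
    (mul_pos (neg_pos.2 ht₁) hpos).trans_le (hle u t₁ x₁ hu hsg ht₁)
  -- ## a maximising sequence, normalised to `(-1, 0)`
  obtain ⟨Λs, -, hΛlim, hΛmem⟩ := exists_seq_tendsto_sSup hSne hSbdd
  have hseq : ∀ k, ∃ w : ℝ → EuclideanSpace ℝ (Fin 3) → EuclideanSpace ℝ (Fin 3),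
      IsTypeIAncientMild C w ∧ Sg w ∧ ⟪curl (w (-1)) 0, e3⟫ = Λs k := by
    intro k
    obtain ⟨v, t, x, hv, hvs, ht, hΛ⟩ := hΛmem k
    obtain ⟨v', hv', hvs', heq⟩ := hzoom v hv hvs t ht x
    exact ⟨v', hv', hvs', by rw [heq, hΛ]⟩
  choose w hwc hws hwΛ using hseq
  -- ## compactness
  obtain ⟨φ, hφ, W, hWc, -, hptG, -, -⟩ := exists_tendsto_of_isTypeIAncientMild_seq C hwc
  have hcurl : ∀ t < 0, ∀ x, Tendsto (fun j => ⟪curl (w (φ j) t) x, e3⟫) atTop (𝓝 ⟪curl (W t) x, e3⟫) :=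
    fun t ht x => tendsto_inner_curl_e3_of_tendsto_fderiv (hptG t ht x)
  have hWs : Sg W := fun t ht x => ge_of_tendsto' (hcurl t ht x) fun j => hws (φ j) t ht x
  -- ## the supremum is attained at `(-1, 0)` by `W`
  have hMW : ⟪curl (W (-1)) 0, e3⟫ = M := by
    have h1 : Tendsto (fun j => ⟪curl (w (φ j) (-1)) 0, e3⟫) atTop (𝓝 M) := by
      have h := hΛlim.comp hφ.tendsto_atTop
      exact h.congr fun j => by simp only [comp_apply, hwΛ]
    exact tendsto_nhds_unique (hcurl (-1) (by norm_num) 0) h1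
  exact ⟨W, hWc, hWs, M, hMpos, hMW, fun v hv hvs t ht x => hle v t x hv hvs ht⟩

/-! ### Door vocabulary -/

variable {W : ℝ → EuclideanSpace ℝ (Fin 3) → EuclideanSpace ℝ (Fin 3)}

/-- **EXTREMAL CLOSED-HEMISPHERE PROFILE (door vocabulary).**  If a closed-hemisphere profile `v` of the route's Type-I
ancient Oseen-mild class (rate `C`) has `⟪curl v(s₀)(y₀), e₃⟫ > 0` somewhere, then there are a closed-hemisphere profile
`W` of the SAME class and `M > 0` such that `⟪curl W(−1)(0), e₃⟫ = M` while `(−s)·⟪curl u(s)(y), e₃⟫ ≤ M` for every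
closed-hemisphere profile `u` of the class (rate `C`), all `s < 0`, `y` — in particular for `u = W` and `u = v`.
[cite: KochNadirashviliSereginSverak2009, Prop. 4.1 and Lemma 6.1 (arXiv:0709.3599 pp. 8, 11)] -/
theorem exists_extremal_hemisphereProfile :
    ∀ (C : ℝ) (v : ℝ → EuclideanSpace ℝ (Fin 3) → EuclideanSpace ℝ (Fin 3)),
    Literature.Analysis.FluidPDE.HasTypeITimeDecay C v →
    ContinuousOn (Function.uncurry v) (Set.Iio (0 : ℝ) ×ˢ Set.univ) →
    (∀ s t : ℝ, s < t → t < 0 → ∀ x, v t x =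
      Literature.Analysis.UnboundedOperators.heatExtension (v s) (t - s) x -
        Literature.Analysis.FluidPDE.oseenDuhamel 1 s v v t x) →
    (∀ t < 0, Literature.Analysis.FluidPDE.VectorCalculus.IsDivFree (v t)) →
    (∀ s < 0, ∀ y, 0 ≤ ⟪Literature.Analysis.FluidPDE.curl (v s) y, e3⟫_ℝ) →
    (∃ s₀ : ℝ, s₀ < 0 ∧ ∃ y₀, 0 < ⟪Literature.Analysis.FluidPDE.curl (v s₀) y₀, e3⟫_ℝ) →
    ∃ (W : ℝ → EuclideanSpace ℝ (Fin 3) → EuclideanSpace ℝ (Fin 3)) (M : ℝ),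
      (Literature.Analysis.FluidPDE.HasTypeITimeDecay C W ∧
        ContinuousOn (Function.uncurry W) (Set.Iio (0 : ℝ) ×ˢ Set.univ) ∧
        (∀ s t : ℝ, s < t → t < 0 → ∀ x, W t x =
          Literature.Analysis.UnboundedOperators.heatExtension (W s) (t - s) x -
            Literature.Analysis.FluidPDE.oseenDuhamel 1 s W W t x) ∧
        (∀ t < 0, Literature.Analysis.FluidPDE.VectorCalculus.IsDivFree (W t))) ∧
      (∀ s < 0, ∀ y, 0 ≤ ⟪Literature.Analysis.FluidPDE.curl (W s) y, e3⟫_ℝ) ∧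
      0 < M ∧ ⟪Literature.Analysis.FluidPDE.curl (W (-1)) 0, e3⟫_ℝ = M ∧
      ∀ (u : ℝ → EuclideanSpace ℝ (Fin 3) → EuclideanSpace ℝ (Fin 3)),
        Literature.Analysis.FluidPDE.HasTypeITimeDecay C u →
        ContinuousOn (Function.uncurry u) (Set.Iio (0 : ℝ) ×ˢ Set.univ) →
        (∀ s t : ℝ, s < t → t < 0 → ∀ x, u t x =
          Literature.Analysis.UnboundedOperators.heatExtension (u s) (t - s) x -
            Literature.Analysis.FluidPDE.oseenDuhamel 1 s u u t x) →
        (∀ t < 0, Literature.Analysis.FluidPDE.VectorCalculus.IsDivFree (u t)) →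
        (∀ s < 0, ∀ y, 0 ≤ ⟪Literature.Analysis.FluidPDE.curl (u s) y, e3⟫_ℝ) →
        ∀ s < 0, ∀ y, (-s) * ⟪Literature.Analysis.FluidPDE.curl (u s) y, e3⟫_ℝ ≤ M := by
  intro C v hrate hcont hmild hdiv hsg hpos
  obtain ⟨s₀, hs₀, y₀, hy₀⟩ := hpos
  have hv : IsTypeIAncientMild C v := isTypeIAncientMild_of_class hrate hcont hmild hdiv
  obtain ⟨W, hW, hWs, M, hM, hMW, hmax⟩ := exists_extremal_typeIAncientMild C hv hsg hs₀ hy₀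
  refine ⟨W, M, ⟨hW.hasTypeITimeDecay, hW.continuousOn_uncurry,
    fun s t hst ht x => hW.mild_eq_heatExtension hst ht x, fun t ht => hW.isDivFree ht⟩,
    hWs, hM, hMW, fun u hr hc hm hd hs => ?_⟩
  exact hmax u (isTypeIAncientMild_of_class hr hc hm hd) hs

/-! ### The extremal point -/

/-- **WHAT HOLDS AT THE EXTREMAL POINT.**  Let `W` be a profile of the route's Type-I ancient Oseen-mild class whose
scale-invariant `e₃`-vorticity `(−s)·⟪curl W(s)(y), e₃⟫` is `≤ M` everywhere on `(−∞,0) × ℝ³` and `= M` at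
`(s,y) = (−1, 0)`.  Then at `(−1, 0)`:  `∇ω₃ = 0`,  `Δω₃ ≤ 0`,  `∂ₛω₃ = M`,  and the `e₃`-stretching equals
`M − Δω₃`, hence is `≥ M = ω₃(−1,0)` — the `e₃`-vorticity of an extremal profile is stretched AT LEAST AT THE
SIMILARITY RATE at its extremal point (first- and second-order conditions in space, Fermat in time on the open
interval `(−∞,0)`, and the `e₃`-vorticity equation `∂ₛω₃ = Δω₃ − Dω₃[W] + ⟪DW[ω], e₃⟫`).
[cite: MajdaBertozziCUP2002, Prop. 2.4 eq. (2.110); folklore] -/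
theorem extremal_point_conditions {C M : ℝ} (hrate : HasTypeITimeDecay C W)
    (hcont : ContinuousOn (uncurry W) (Iio (0 : ℝ) ×ˢ univ))
    (hmild : ∀ s t : ℝ, s < t → t < 0 → ∀ x,
      W t x = UnboundedOperators.heatExtension (W s) (t - s) x - oseenDuhamel 1 s W W t x)
    (hdiv : ∀ t < 0, VectorCalculus.IsDivFree (W t))
    (hmax : ∀ s < 0, ∀ y, (-s) * ⟪curl (W s) y, e3⟫ ≤ M) (hval : ⟪curl (W (-1)) 0, e3⟫ = M) :
    fderiv ℝ (fun z => ⟪curl (W (-1)) z, e3⟫) 0 = 0 ∧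
      (Δ fun z => ⟪curl (W (-1)) z, e3⟫) 0 ≤ 0 ∧
      HasDerivAt (fun s => ⟪curl (W s) 0, e3⟫) M (-1) ∧
      ⟪fderiv ℝ (W (-1)) 0 (curl (W (-1)) 0), e3⟫ = M - (Δ fun z => ⟪curl (W (-1)) z, e3⟫) 0 ∧
      M ≤ ⟪fderiv ℝ (W (-1)) 0 (curl (W (-1)) 0), e3⟫ := by
  -- the class is classical, hence a vorticity solution on `(−∞,0)`
  obtain ⟨q, hcl⟩ := exists_classical_of_class hrate hcont hmild hdiv
  have hS : IsOpen (Iio (0 : ℝ)) := isOpen_Iio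
  have hV : IsVorticitySolutionOn (Iio (0 : ℝ)) 1 W :=
    hcl.isVorticitySolutionOn_zero_force hS.uniqueDiffOn (by rw [interior_Iio]; exact subset_closure)
  have hω : IsSmoothSpaceTimeOn (Iio (0 : ℝ)) (vorticity W) :=
    hV.smooth_velocity.isSmoothSpaceTimeOn_vorticity hS.uniqueDiffOn
  have hω3s : IsSmoothSpaceTimeOn (Iio (0 : ℝ)) fun t y => ⟪curl (W t) y, e3⟫ :=
    hω.inner (isSmoothSpaceTimeOn_const_time contDiff_const _)
  have h1 : (-1 : ℝ) < 0 := by norm_num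
  set f : EuclideanSpace ℝ (Fin 3) → ℝ := fun z => ⟪curl (W (-1)) z, e3⟫ with hf
  have hf2 : ContDiff ℝ 2 f := (hω3s.contDiff_slice h1).of_le (by norm_cast)
  -- ## space: `f ≤ M = f 0`
  have hfle : ∀ z, f z ≤ f 0 := by
    intro z
    have h := hmax (-1) h1 z
    rw [neg_neg, one_mul] at h
    simp only [hf]
    rw [hval]
    exact h
  have hloc : IsLocalMax f 0 := Filter.Eventually.of_forall hfle
  have hgrad : fderiv ℝ f 0 = 0 := hloc.fderiv_eq_zero
  have hlap : (Δ f) 0 ≤ 0 := IsLocalMax.laplacian_nonpos hf2 hloc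
  -- ## time: `g(s) = (−s) f_s(0) ≤ M = g(−1)` near `s = −1`
  have hD := hasDerivAt_inner_curl_e3 hV h1 (0 : EuclideanSpace ℝ (Fin 3))
  set D : ℝ := (Δ fun z => ⟪curl (W (-1)) z, e3⟫) 0 - fderiv ℝ (fun z => ⟪curl (W (-1)) z, e3⟫) 0 (W (-1) 0)
    + ⟪fderiv ℝ (W (-1)) 0 (curl (W (-1)) 0), e3⟫ with hDdef
  have hg : HasDerivAt (fun s : ℝ => (-s) * ⟪curl (W s) 0, e3⟫) ((-1) * ⟪curl (W (-1)) 0, e3⟫ + (-(-1)) * D) (-1) :=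
    (hasDerivAt_neg' (-1 : ℝ)).mul hD
  have hgmax : IsLocalMax (fun s : ℝ => (-s) * ⟪curl (W s) 0, e3⟫) (-1) := by
    filter_upwards [Iio_mem_nhds h1] with s hs
    have h := hmax s hs 0
    rw [neg_neg, one_mul, hval]
    exact h
  have htime : (-1) * ⟪curl (W (-1)) 0, e3⟫ + (-(-1)) * D = 0 := hgmax.hasDerivAt_eq_zero hg
  rw [hval] at htime
  have hDM : D = M := by linarith
  -- ## assemble
  have hdrift : fderiv ℝ (fun z => ⟪curl (W (-1)) z, e3⟫) 0 (W (-1) 0) = 0 := by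
    change fderiv ℝ f 0 (W (-1) 0) = 0
    simp [hgrad]
  have hstretch : ⟪fderiv ℝ (W (-1)) 0 (curl (W (-1)) 0), e3⟫ = M - (Δ fun z => ⟪curl (W (-1)) z, e3⟫) 0 := by
    rw [← hDM, hDdef, hdrift]
    ring
  refine ⟨hgrad, hlap, ?_, hstretch, ?_⟩
  · rw [← hDM]; exact hD
  · rw [hstretch]
    change M ≤ M - (Δ f) 0
    linarith

/-! ### The reduction -/

/-- **REDUCTION OF THE OPEN STUB TO THE EXCLUSION OF EXTREMAL PROFILES.**  `HemisphereLiouvilleE3` (closed-hemisphere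
Type-I ancient Oseen-mild profiles are poloidal along `e₃`) holds if and only if NO closed-hemisphere profile of the
class attains a positive maximum `M` of the scale-invariant `e₃`-vorticity `(−s)·⟪curl W(s)(y), e₃⟫` at `(−1, 0)`
(`→`: such a profile has `⟪curl W(−1)(0), e₃⟫ = M > 0`; `←`: `exists_extremal_hemisphereProfile`).  At such an
extremal point `extremal_point_conditions` apply. [cite: KochNadirashviliSereginSverak2009, Prop. 4.1 and Lemma 6.1 (arXiv:0709.3599 pp. 8, 11); folklore] -/
theorem hemisphereLiouvilleE3_iff_no_extremal :
    HemisphereLiouvilleE3 ↔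
      ∀ (C M : ℝ) (W : ℝ → EuclideanSpace ℝ (Fin 3) → EuclideanSpace ℝ (Fin 3)),
        Literature.Analysis.FluidPDE.HasTypeITimeDecay C W →
        ContinuousOn (Function.uncurry W) (Set.Iio (0 : ℝ) ×ˢ Set.univ) →
        (∀ s t : ℝ, s < t → t < 0 → ∀ x, W t x =
          Literature.Analysis.UnboundedOperators.heatExtension (W s) (t - s) x -
            Literature.Analysis.FluidPDE.oseenDuhamel 1 s W W t x) →
        (∀ t < 0, Literature.Analysis.FluidPDE.VectorCalculus.IsDivFree (W t)) →
        (∀ s < 0, ∀ y, 0 ≤ ⟪Literature.Analysis.FluidPDE.curl (W s) y, e3⟫_ℝ) →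
        0 < M → (∀ s < 0, ∀ y, (-s) * ⟪Literature.Analysis.FluidPDE.curl (W s) y, e3⟫_ℝ ≤ M) →
        ⟪Literature.Analysis.FluidPDE.curl (W (-1)) 0, e3⟫_ℝ = M → False := by
  constructor
  · intro hL C M W hrate hcont hmild hdiv hsg hM _ hval
    have h0 := hL C W hrate hcont hmild hdiv hsg (-1) (by norm_num) 0
    linarith
  · intro hno C v hrate hcont hmild hdiv hsg s hs y
    by_contra hne
    have hpos : 0 < ⟪curl (v s) y, e3⟫ := lt_of_le_of_ne (hsg s hs y) (Ne.symm hne)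
    obtain ⟨W, M, ⟨hr, hc, hm, hd⟩, hWs, hM, hMW, hmax⟩ :=
      exists_extremal_hemisphereProfile C v hrate hcont hmild hdiv hsg ⟨s, hs, y, hpos⟩
    exact hno C M W hr hc hm hd hWs hM (hmax W hr hc hm hd hWs) hMW

end Summit.NavierStokesRegularity.NavierStokesRegularity.Theorems.HalfSpaceWindowDoorCirculationCarryingRigidityExtremalProfile

end
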